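import Literature.NumberTheory.Transcendental.KZSemialgebraicComplex
import HarnessLib

/-!
# Semialgebraic sets over a real-algebraic coefficient field are `ℚ`-semialgebraic

Let `k` be a commutative ring mapping to `ℝ` (`[Algebra k ℝ]`) whose image consists of real
algebraic numbers — e.g. a number field with a real embedding, or `ℚ̄ ∩ ℝ` itself. Then every
`k`-semialgebraic subset of `ℝⁿ` (a Boolean combination of sign conditions on polynomials with
coefficients in `k`, `Literature.ModelTheory.ExponentialFields.IsSemialgebraic k`) is already
`ℚ`-semialgebraic (`IsSemialgebraic.rat_of_isAlgebraic`, declared with its absolute name in the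
namespace of `IsSemialgebraic` for dot notation; likewise the function and map versions
`IsSemialgebraicFunOn.rat_of_isAlgebraic`, `IsSemialgebraicMapOn.rat_of_isAlgebraic`).

Proof: by induction over the generating Boolean combinations it suffices to treat a sign condition
`p(x) = 0` or `p(x) > 0` for one `p ∈ k[x₁, …, xₙ]`. Writing `p = Σ_j c_j x^{m_j}` over its support,
`p(x) = P(x, a)` for the polynomial `P = Σ_j y_j x^{m_j} ∈ ℚ[x, y]` and the point
`a = (c_j)_j ∈ ℝʳ` of real algebraic coordinates (`exists_mvPolynomial_rat_aeval_eq`); the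
singleton `{a}` is `ℚ`-semialgebraic because a real algebraic number is isolated among the real
roots of its minimal polynomial by rational bounds (the tree's
`Literature.NumberTheory.Transcendental.isSemialgebraic_setOf_apply_eq_of_isAlgebraic`), and the sign
condition on `p` is the projection to the `x`-coordinates of the `ℚ`-semialgebraic set
`{(x, y) | P(x, y) ∗ 0, y = a}`, which is `ℚ`-semialgebraic by the Tarski–Seidenberg theorem (the
tree's `IsSemialgebraic.image_comp`, from `tarski_seidenberg_real_holds`). This is the remark of
Kontsevich–Zagier (*Periods*, §1.1) that "rational" may equivalently be replaced by "algebraic" in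
the definition of the coefficient field of a period, in its set-theoretic form (Bochnak–Coste–Roy,
Prop. 5.1.5 / Tarski–Seidenberg with parameters: a set definable with real-algebraic parameters is
definable over `ℚ`).

Used by the real Abel–Jacobi package (`RealAbelJacobi.exists_realization`): real points of a
variety over a real-algebraic field `k ⊆ ℝ` form a `ℚ`-semialgebraic set. Everything is proved; no
named fact is introduced.

## References

* M. Kontsevich, D. Zagier, *Periods* (2001), §1.1. [KontsevichZagier2001]
* J. Bochnak, M. Coste, M.-F. Roy, *Real Algebraic Geometry* (1998), Thm. 2.2.1, Prop. 2.2.7.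
  [BochnakCosteRoy1998]
-/

noncomputable section

open Set MvPolynomial
open Literature.ModelTheory.ExponentialFields Literature.NumberTheory.Transcendental

namespace Literature.AlgebraicGeometry.RealAlgebraic

variable {k : Type*} [CommRing k] [Algebra k ℝ] {n : ℕ}

/-- **A polynomial with real-algebraic coefficients is a rational polynomial in the variables and
its coefficients.** For `p ∈ k[x₁, …, xₙ]` there are `r`, a point `a ∈ ℝʳ` (the images of the
coefficients of `p`, enumerated along the support) and `P ∈ ℚ[x₁, …, xₙ, y₁, …, y_r]` (namely
`Σ_j y_j x^{m_j}`) with `p(x) = P(x, y)` whenever `y = a`; if `k` maps into the real algebraic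
numbers, the `a_j` are algebraic. [folklore] -/
theorem exists_mvPolynomial_rat_aeval_eq (p : MvPolynomial (Fin n) k) :
    ∃ (r : ℕ) (a : Fin r → ℝ) (P : MvPolynomial (Fin (n + r)) ℚ),
      (∀ j, ∃ c : k, a j = algebraMap k ℝ c) ∧
      ∀ w : Fin (n + r) → ℝ, (∀ j, w (Fin.natAdd n j) = a j) →
        aeval w P = aeval (fun i => w (Fin.castAdd r i)) p := by
  classical
  set r := p.support.card with hr
  let e : p.support ≃ Fin r := p.support.equivFin
  let m : Fin r → (Fin n →₀ ℕ) := fun j => (e.symm j).1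
  let a : Fin r → ℝ := fun j => algebraMap k ℝ (coeff (m j) p)
  let P : MvPolynomial (Fin (n + r)) ℚ :=
    ∑ j : Fin r, X (Fin.natAdd n j) * rename (Fin.castAdd r) (monomial (m j) (1 : ℚ))
  refine ⟨r, a, P, fun j => ⟨coeff (m j) p, rfl⟩, fun w hw => ?_⟩
  set x : Fin n → ℝ := fun i => w (Fin.castAdd r i) with hx
  -- left-hand side: `Σ_j a_j x^{m_j}`
  have hL : aeval w P = ∑ j : Fin r, a j * aeval x (monomial (m j) (1 : ℚ)) := by
    simp only [P, map_sum, map_mul, aeval_X, aeval_rename, hw]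
    rfl
  -- right-hand side: `Σ_{s ∈ supp p} c_s x^s`, re-indexed along `e`
  have hmon : ∀ (s : Fin n →₀ ℕ), aeval x (monomial s (coeff s p)) =
      algebraMap k ℝ (coeff s p) * aeval x (monomial s (1 : ℚ)) := by
    intro s
    have h1 : monomial s (coeff s p) = C (coeff s p) * monomial s (1 : k) := by
      rw [C_mul_monomial, mul_one]
    rw [h1, map_mul, aeval_C, aeval_monomial, aeval_monomial, map_one, map_one]
  have hR : aeval x p = ∑ j : Fin r, a j * aeval x (monomial (m j) (1 : ℚ)) := by
    conv_lhs => rw [p.as_sum]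
    rw [map_sum, ← Finset.sum_coe_sort, ← Equiv.sum_comp e.symm]
    refine Finset.sum_congr rfl fun j _ => ?_
    exact hmon _
  rw [hL, hR]

/-- Coordinate hyperplanes `{w | w i = c}` with `c` real algebraic are `ℚ`-semialgebraic in `ℝ^ι`
for any index type (transport of the tree's `isSemialgebraic_setOf_apply_eq_of_isAlgebraic` along
the coordinate `i`). [cite: KontsevichZagier2001, §1.1] -/
theorem isSemialgebraic_setOf_apply_eq_of_isAlgebraic' {ι : Type*} {c : ℝ} (hc : IsAlgebraic ℚ c)
    (i : ι) : IsSemialgebraic ℚ {w : ι → ℝ | w i = c} := by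
  have h := (isSemialgebraic_setOf_apply_eq_of_isAlgebraic (n := 1) hc 0).preimage_comp
    (ι := ι) (fun _ : Fin 1 => i)
  exact h

/-- **Sign conditions on a polynomial with real-algebraic coefficients are `ℚ`-semialgebraic.**
For `p ∈ k[x₁, …, xₙ]` with `k` mapping into the real algebraic numbers and any condition `R` on
the value, `{x | R (p x)}` is the projection of `{(x, y) | R (P(x, y)), y = a}` with `P` rational and
`a` real algebraic (`exists_mvPolynomial_rat_aeval_eq`); it is `ℚ`-semialgebraic as soon as
`{w | R (P w)}` is (Tarski–Seidenberg, `IsSemialgebraic.image_comp`).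
[cite: BochnakCosteRoy1998, Thm. 2.2.1] -/
theorem isSemialgebraic_setOf_aeval_of_isAlgebraic (hk : ∀ c : k, IsAlgebraic ℚ (algebraMap k ℝ c))
    (p : MvPolynomial (Fin n) k) (R : ℝ → Prop)
    (hR : ∀ (q : ℕ) (P : MvPolynomial (Fin q) ℚ), IsSemialgebraic ℚ {w : Fin q → ℝ | R (aeval w P)}) :
    IsSemialgebraic ℚ {x : Fin n → ℝ | R (aeval x p)} := by
  obtain ⟨r, a, P, ha, hP⟩ := exists_mvPolynomial_rat_aeval_eq p
  have ha' : ∀ j, IsAlgebraic ℚ (a j) := fun j => by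
    obtain ⟨c, hc⟩ := ha j
    rw [hc]
    exact hk c
  have hW : IsSemialgebraic ℚ ({w : Fin (n + r) → ℝ | R (aeval w P)} ∩
      ⋂ j ∈ (Finset.univ : Finset (Fin r)), {w | w (Fin.natAdd n j) = a j}) :=
    (hR _ P).inter (IsSemialgebraic.biInter _ _ fun j _ =>
      isSemialgebraic_setOf_apply_eq_of_isAlgebraic' (ha' j) _)
  convert hW.image_comp (Fin.castAdd r) using 1
  ext x
  simp only [mem_setOf_eq, mem_image, mem_inter_iff, mem_iInter, Finset.mem_univ, forall_const]
  constructor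
  · intro hx
    refine ⟨Fin.append x a, ⟨?_, fun j => Fin.append_right x a j⟩, ?_⟩
    · rw [hP _ fun j => Fin.append_right x a j]
      convert hx using 3
      funext i
      exact Fin.append_left x a i
    · funext i
      exact Fin.append_left x a i
  · rintro ⟨w, ⟨hw, hwa⟩, rfl⟩
    rw [hP w hwa] at hw
    exact hw

/-- **Semialgebraic sets over a real-algebraic coefficient field are `ℚ`-semialgebraic.** If every
element of `k` maps to a real algebraic number, every `k`-semialgebraic subset of `ℝⁿ` is
`ℚ`-semialgebraic: induction over the Boolean combinations, the generating sign conditions being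
`ℚ`-semialgebraic by `isSemialgebraic_setOf_aeval_of_isAlgebraic` (real algebraic parameters are
`ℚ`-definable and Tarski–Seidenberg eliminates them). This is the set form of Kontsevich–Zagier's
remark (*Periods*, §1.1) that algebraic coefficients give the same class of domains as rational
ones. [cite: KontsevichZagier2001, §1.1] [cite: BochnakCosteRoy1998, Thm. 2.2.1] -/
theorem _root_.Literature.ModelTheory.ExponentialFields.IsSemialgebraic.rat_of_isAlgebraic (hk : ∀ c : k, IsAlgebraic ℚ (algebraMap k ℝ c))
    {s : Set (Fin n → ℝ)} (hs : IsSemialgebraic k s) : IsSemialgebraic ℚ s := by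
  induction hs using BooleanSubalgebra.closure_bot_sup_induction with
  | mem s hs =>
    rcases hs with ⟨p, rfl⟩ | ⟨p, rfl⟩
    · exact isSemialgebraic_setOf_aeval_of_isAlgebraic hk p (fun t => t = 0)
        fun q P => isSemialgebraic_setOf_eval_eq_zero P
    · exact isSemialgebraic_setOf_aeval_of_isAlgebraic hk p (fun t => 0 < t)
        fun q P => isSemialgebraic_setOf_eval_pos P
  | bot => exact isSemialgebraic_empty
  | sup s _ t _ hs ht => exact hs.union ht
  | compl s _ hs => exact hs.compl

/-- Functions version: a `k`-semialgebraic function on a `k`-semialgebraic set is `ℚ`-semialgebraic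
when `k` maps into the real algebraic numbers (its graph is). [cite: KontsevichZagier2001, §1.1] -/
theorem _root_.Literature.NumberTheory.Transcendental.IsSemialgebraicFunOn.rat_of_isAlgebraic (hk : ∀ c : k, IsAlgebraic ℚ (algebraMap k ℝ c))
    {s : Set (Fin n → ℝ)} {f : (Fin n → ℝ) → ℝ} (hf : IsSemialgebraicFunOn k s f) :
    IsSemialgebraicFunOn ℚ s f :=
  IsSemialgebraic.rat_of_isAlgebraic hk hf

/-- Maps version: a `k`-semialgebraic map on a `k`-semialgebraic set is `ℚ`-semialgebraic when `k`
maps into the real algebraic numbers (its graph is). [cite: KontsevichZagier2001, §1.1] -/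
theorem _root_.Literature.NumberTheory.Transcendental.IsSemialgebraicMapOn.rat_of_isAlgebraic (hk : ∀ c : k, IsAlgebraic ℚ (algebraMap k ℝ c))
    {m : ℕ} {s : Set (Fin n → ℝ)} {f : (Fin n → ℝ) → (Fin m → ℝ)}
    (hf : IsSemialgebraicMapOn k s f) : IsSemialgebraicMapOn ℚ s f :=
  IsSemialgebraic.rat_of_isAlgebraic hk hf

end Literature.AlgebraicGeometry.RealAlgebraic

end
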